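import Literature.IUT.HodgeTheaters.PuncturedEllipticCoveringsOpenProofs
import Literature.IUT.HodgeTheaters.PuncturedEllipticCoveringsCusps
import Literature.IUT.HodgeTheaters.InitialThetaDataLocalPuncturedData
import HarnessLib

/-!
# [IUTchI] §1 p. 38 / Def. 3.1 (f) p. 63: the openness clause `ArrowOpenClaims` DERIVED, and `Π_{X̲→_K} ⊆ Π_{C_F}`
# open (the `hX` of Ex. 3.3 at the datum) from typed interfaces only (proofs only)

S. Mochizuki, *Inter-universal Teichmüller theory I*, §1 (kurims May-2020 manuscript p. 38: the arrows of the
cartesian diagram are "open immersions of profinite groups") and Def. 3.1 (d), (f) (pp. 62–63: "`Π_{X_K} → Π_{X_F}`,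
`Π_{C_K} → Π_{C_F}` … open immersions of profinite groups", "the data `(X_K, C̲_K, ε̲)` determines … open subgroups
`Π_{X̲→_K} ⊆ Π_{C̲→_K} ⊆ Π_{C_F}`") [claim: Mochizuki2012, status: disputed].

`Proofs` companion (theorems only; no definitions, no instances) JOINING this seat's
`PuncturedEllipticCoveringsOpenProofs.lean` (p424558: `Π_{X→}`, `Π_{C→}` are open given `ArrowCoveringClaims`,
topological finite generation of `Δ_X̲` and closedness of `D_{2ε}`) with abc-iut-L5-t1's `PuncturedEllipticCoveringsCusps.lean`
(the openness PREDICATE `PuncturedEllipticData.ArrowOpenClaims` and the cusp INTERFACE `PuncturedEllipticData.CuspGalois`,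
whose law `isClosed_decomp` is the closedness input). RESULT: the predicate `ArrowOpenClaims` is a THEOREM given
`ArrowCoveringClaims` (printed p. 38 claims), [AbsTopI] Prop. 2.2 for `Δ_C` (`FundamentalExtension.GeomTFG`) and
`CuspGalois` (`arrowOpenClaims_of_claims_of_geomTFG`); at the InitialThetaData level the tfg input may be cited for the
`F`-core `Π_{C_F} ↠ G_F` (`geomTFG_pe_iff`: `embK` restricts to a bicontinuous isomorphism `Δ_{C_K} ⥲ Δ_C`, Def. 3.1 (d)),
so the openness of `Π_{X̲→_K} = embK(Π_{X→}) ⊆ Π_{C_F}` (the open immersion `isOpenEmbedding_embK`, p419870) — the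
hypothesis `hX` of `InitialThetaData.goodLocalFrobenioidOfEmb` (Ex. 3.3 at the datum, p419029), and with it every
`…_of_arrowOpenClaims` consequence of abc-iut-L5-t2's `InitialThetaDataArrowOpenProofs.lean` (p425530) — holds given
`(h : D.geom.pe.ArrowCoveringClaims) (hΔ : D.geom.extF.GeomTFG) (C : D.geom.pe.CuspGalois)`.
Nothing of the disputed series is asserted; no side is taken; no statement of the paper is strengthened.
-/

namespace Literature.IUT.HodgeTheaters

open Literature.AnabelianGeometry.AbsoluteAnabelian Topology

universe u v w

/-! ### p. 38 "open immersions": `ArrowOpenClaims` from `ArrowCoveringClaims` + `GeomTFG` + `CuspGalois` -/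

namespace PuncturedEllipticData

variable (D : PuncturedEllipticData.{u})

/-- **[IUTchI] §1 p. 38, the openness clause DERIVED**: given the printed claims `ArrowCoveringClaims`, [AbsTopI]
Prop. 2.2 for `Δ_C` (`GeomTFG`) and the cusp interface `CuspGalois` (of which only `isClosed_decomp` at `2ε̲` is
used), `Π_{X→}` and `Π_{C→}` are open in `Π_C`, i.e. `ArrowOpenClaims D` holds. ([IUTchI] §1 p.38)
[claim: Mochizuki2012, status: disputed] -/
theorem arrowOpenClaims_of_claims_of_geomTFG (h : D.ArrowCoveringClaims) (hΔ : D.E.GeomTFG)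
    (C : D.CuspGalois) : D.ArrowOpenClaims :=
  ⟨D.isOpen_piXarrow_of_claims_of_geomTFG h hΔ (C.isClosed_decomp D.twoε),
    D.isOpen_piCarrow_of_claims_of_geomTFG h hΔ (C.isClosed_decomp D.twoε)⟩

/-- The same with topological finite generation of `Δ_X̲` itself as the input. ([IUTchI] §1 p.38)
[claim: Mochizuki2012, status: disputed] -/
theorem arrowOpenClaims_of_claims_of_tfg (h : D.ArrowCoveringClaims)
    (htfg : IsTopologicallyFinitelyGenerated ↥D.DeltaXbar) (C : D.CuspGalois) : D.ArrowOpenClaims :=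
  ⟨D.isOpen_piXarrow_of_claims h htfg (C.isClosed_decomp D.twoε),
    D.isOpen_piCarrow_of_claims h htfg (C.isClosed_decomp D.twoε)⟩

end PuncturedEllipticData

/-! ### Def. 3.1 (d): `Δ_{C_K} = Δ_{C_F}`; Def. 3.1 (f): `Π_{X̲→_K}`, `Π_{C̲→_K}` open from typed interfaces -/

namespace InitialThetaData

variable {F : Type u} {K : Type v} {Fbar : Type w} [Field F] [NumberField F] [Field K] [NumberField K]
  [Algebra F K] [Field Fbar] [Algebra F Fbar] [Algebra K Fbar]
  {E : WeierstrassCurve F} [E.IsElliptic] {l : ℕ} {Pb : BadPlacePredicates K}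
  (D : InitialThetaData F K Fbar E l Pb)

/-- **`Δ_{C_K} = Δ_{C_F}`**: [AbsTopI] Prop. 2.2 (topological finite generation of the geometric fundamental group)
for the `K`-level extension `Π_{C_K} ↠ G_K` is EQUIVALENT to the same for the `F`-core `Π_{C_F} ↠ G_F` — `embK`
restricts to a bicontinuous isomorphism `Δ_{C_K} ⥲ Δ_C` (Def. 3.1 (d): "`Π_{X_K} → Π_{X_F}`, `Π_{C_K} → Π_{C_F}` … open
immersions of profinite groups"; the geometric fundamental group is unchanged by base change).
([IUTchI] Def 3.1 (d) p.62) [claim: Mochizuki2012, status: disputed] -/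
theorem geomTFG_pe_iff : D.geom.pe.E.GeomTFG ↔ D.geom.extF.GeomTFG := by
  let f : ↥D.geom.pe.E.geom →* ↥D.DeltaC :=
    { toFun := fun y => ⟨D.geom.embK y, (D.embK_mem_deltaC_iff y).mpr y.2⟩
      map_one' := Subtype.ext (by simp)
      map_mul' := fun a b => Subtype.ext (by simp) }
  have hf : Continuous f := (D.geom.embK_continuous.comp continuous_subtype_val).subtype_mk _
  have hbij : Function.Bijective f := by
    refine ⟨fun a b h => Subtype.ext (D.geom.embK_injective (congrArg Subtype.val h)), fun x => ?_⟩
    have hx : (x : D.PiC) ∈ Set.range D.geom.embK := by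
      rw [D.range_embK, Set.mem_preimage, (D.augGF_eq_one_iff x).mpr x.2]
      exact (galoisSubgroupOf F K Fbar).one_mem
    obtain ⟨y, hy⟩ := hx
    exact ⟨⟨y, (D.embK_mem_deltaC_iff y).mp (hy ▸ x.2)⟩, Subtype.ext hy⟩
  haveI : CompactSpace ↥D.geom.pe.E.geom :=
    isCompact_iff_compactSpace.mp D.geom.pe.E.isClosed_geom.isCompact
  let eₜ : ↥D.geom.pe.E.geom ≃ₜ ↥D.DeltaC :=
    Continuous.homeoOfEquivCompactToT2 (f := Equiv.ofBijective f hbij) hf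
  let e : ↥D.geom.pe.E.geom ≃ₜ* ↥D.DeltaC :=
    { MulEquiv.ofBijective f hbij with
      continuous_toFun := hf
      continuous_invFun := eₜ.continuous_symm }
  exact ⟨fun h => h.of_continuousMulEquiv e, fun h => h.of_continuousMulEquiv e.symm⟩

/-- **The §1 openness clause for the `K`-level datum `D.geom.pe` is a THEOREM** given its printed claims
(`ArrowCoveringClaims`), [AbsTopI] Prop. 2.2 for the `F`-core (`D.geom.extF.GeomTFG`) and its cusp interface
(`CuspGalois`): feeds every `…_of_arrowOpenClaims` consequence of abc-iut-L5-t2's `InitialThetaDataArrowOpenProofs.lean`.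
([IUTchI] §1 p.38; Def 3.1 (d),(f) pp.62–63) [claim: Mochizuki2012, status: disputed] -/
theorem arrowOpenClaims_pe_of_geomTFG (h : D.geom.pe.ArrowCoveringClaims) (hΔ : D.geom.extF.GeomTFG)
    (C : D.geom.pe.CuspGalois) : D.geom.pe.ArrowOpenClaims :=
  D.geom.pe.arrowOpenClaims_of_claims_of_geomTFG h (D.geomTFG_pe_iff.mpr hΔ) C

/-- **Def. 3.1 (f): `Π_{X̲→_K} ⊆ Π_{C_F}` is OPEN** from the printed §1 claims, [AbsTopI] Prop. 2.2 for the `F`-core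
and the cusp interface of the `K`-level datum — the hypothesis `hX` of `InitialThetaData.goodLocalFrobenioidOfEmb`
(Ex. 3.3 (i)–(ii) at the datum, p419029) in terms of typed interfaces only.
([IUTchI] Def 3.1 (f) p.63) [claim: Mochizuki2012, status: disputed] -/
theorem isOpen_PiXarrow_of_cuspGalois [IsScalarTower F K Fbar] (h : D.geom.pe.ArrowCoveringClaims)
    (hΔ : D.geom.extF.GeomTFG) (C : D.geom.pe.CuspGalois) : IsOpen (D.PiXarrow : Set D.PiC) := by
  change IsOpen ((D.geom.pe.piXarrow.map D.geom.embK : Subgroup D.PiC) : Set D.PiC)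
  rw [Subgroup.coe_map]
  exact D.isOpenEmbedding_embK.isOpenMap _ (D.arrowOpenClaims_pe_of_geomTFG h hΔ C).isOpen_piXarrow

/-- **Def. 3.1 (f): `Π_{C̲→_K} ⊆ Π_{C_F}` is OPEN** from the printed §1 claims, [AbsTopI] Prop. 2.2 for the `F`-core
and the cusp interface of the `K`-level datum. ([IUTchI] Def 3.1 (f) p.63) [claim: Mochizuki2012, status: disputed] -/
theorem isOpen_PiCarrow_of_cuspGalois [IsScalarTower F K Fbar] (h : D.geom.pe.ArrowCoveringClaims)
    (hΔ : D.geom.extF.GeomTFG) (C : D.geom.pe.CuspGalois) : IsOpen (D.PiCarrow : Set D.PiC) := by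
  change IsOpen ((D.geom.pe.piCarrow.map D.geom.embK : Subgroup D.PiC) : Set D.PiC)
  rw [Subgroup.coe_map]
  exact D.isOpenEmbedding_embK.isOpenMap _ (D.arrowOpenClaims_pe_of_geomTFG h hΔ C).isOpen_piCarrow

end InitialThetaData

end Literature.IUT.HodgeTheaters
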